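import Summits.Ventures.PercRepro.S2ContractionSeven
import Summits.Ventures.PercRepro.S2ContractionPlanes
import Summits.Ventures.PercRepro.S2ContractionTriples
import Summits.Ventures.PercRepro.S2TailFlats
import Summits.Ventures.PercRepro.S2CountsCell
import Summits.Ventures.PercRepro.S2DichotomyTools
import Summits.Ventures.PercRepro.S2SpanningCount
import Summits.Ventures.PercRepro.S2PhiFourteenFive
import Summits.Ventures.PercRepro.S2CapFree
import Summits.Ventures.PercRepro.TriangleCapEightI
import Summits.Ventures.PercRepro.RankLevelSetFourCircuitNullityFour
import Summits.Ventures.PercRepro.S1FiveCircuitBase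

/-!
# PercRepro — S2: THE CASE `ν = 4` OF THE CELL `(14, 7)` BY THE CONTRACTION LEVER (p7, gen 14; sub-claim S2; the `p = 14` row)

On a coloop-free `e`-free core of rank `14` on `21` points with a set `W` of nullity `4` on `w ≤ 9` points and no set of nullity `5` on
`≤ 10` points: `W` is a FLAT of `w ∈ {8, 9}` points (a point of `cl W ∖ W` would give a nullity-`5` set on `≤ 10` points), `N := M ／ W` has
dual rank `3` on `21 − w` points and no loops, and the top sets are counted through the contraction lever — the `5`-sets by the kit
(`S2.ncard_spanning_compl_le_of_nullity`, `15,102` at `w = 9`), the `6`-sets by `S2.ncard_top_le_sum_contract` (`≤ 17,592`), the `7`-sets by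
`S2.ncard_top_seven_le_contract` (`≤ 12,480`), with the caps `D₂(N) ≤ 6`, `D₃(N) ≤ 70`, the all-pairs-dependent triples `≤ 20`, `D₃(W) ≤ 12`,
`R₄²(W) = 0`, `R₅³(W) ≤ 31` (at `w = 9`) and the trivial splits `I_j + Dep_j ≤ C(w, j)`: `#U ≤ 45,174` against the need `45,594` of the tail
with the rank part at `(f, f′) = (9, 8)` (`ncard_eRk_le_five_le_flats`, `1508161/18`) and the spanning count below `W` (`87,626`; slack
`84/1024`); at `w = 8`: `#U ≤ 35,764` against `46,079` (slack `74/1024`). **`ThmN.c025_fourteen_seven_cf_nu_four`**. Axioms: standard.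
-/

open scoped Matroid

namespace PercRepro

namespace ThmN

open Set

variable {α : Type}

/-- The coloop-free caps at `(14, 7)`: `s₃ ≤ 11`, `s₄ ≤ 56` (`⌊21·46/17⌋` on `avgChain16 6`), `s₅ ≤ 307` (`⌊21·234/16⌋`). -/
theorem caps_fourteen_seven_cf (M : Matroid α) [M.Finite]
    (hd : M.E.encard = M.eRank + ((7 : ℕ) : ℕ∞)) (hn : M.E.ncard = 14 + 7)
    (hfree : ∀ e ∈ M.E, ∃ A ⊆ M.E \ {e}, e ∉ M.closure A ∧ e ∉ M.closure ((M.E \ {e}) \ A)) (hK : ∀ e, ¬ M.IsColoop e) :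
    {C : Set α | M.IsCircuit C ∧ C.ncard = 3}.ncard ≤ 11 ∧
      {C : Set α | M.IsCircuit C ∧ C.ncard = 4}.ncard ≤ 56 ∧
        {C : Set α | M.IsCircuit C ∧ C.ncard = 5}.ncard ≤ 307 := by
  have hs3 := TriangleCap.core_ncard_triangles_le_cq3 M hfree hd
  rw [show TriangleCap.cq3 7 = 11 by decide] at hs3
  have hcol : M.coloops = ∅ := S2.coloops_eq_empty_of_forall_not M hK
  have hm : 21 ≤ (M.E \ M.coloops).ncard := by
    rw [hcol, Set.sdiff_empty, hn]
  have hd' : M.E.encard = M.eRank + (((6 : ℕ) : ℕ∞) + 1) := by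
    rw [hd]; norm_num
  have h := S1.ncard_fourCircuits_sub_div_le_of_nonColoops M hfree hd' (by norm_num) hm (B := 46)
    (fun M' _ hfree' hd'' => by
      have h := ncard_fourCircuits_le_avgChain16 6 M' hfree' hd''
      rw [show avgChain16 6 = 46 by decide] at h
      exact h)
  have hs4 : {C : Set α | M.IsCircuit C ∧ C.ncard = 4}.ncard ≤ 56 := by
    have := S1.le_mul_div_of_sub_div_le (by norm_num : 4 < 21) h
    omega
  have hs5 := S2.ncard_fiveCircuits_le_of_no_coloop M hfree hd' hK (by omega)
  rw [hn] at hs5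
  have h5 : (14 + 7) * S1.avgChain5b 6 / (14 + 7 - 5) = 307 := by
    rw [show S1.avgChain5b 6 = 234 by decide]
  rw [h5] at hs5
  exact ⟨hs3, hs4, hs5⟩

/-- **The case `ν = 4` of the coloop-free cell `(14, 7)`** (see the module docstring). -/
theorem c025_fourteen_seven_cf_nu_four (M : Matroid α) [M.Finite]
    (hR : M.eRank = ((14 : ℕ) : ℕ∞)) (hn : M.E.ncard = 14 + 7)
    (hfree : ∀ e ∈ M.E, ∃ A ⊆ M.E \ {e}, e ∉ M.closure A ∧ e ∉ M.closure ((M.E \ {e}) \ A)) (hK : ∀ e, ¬ M.IsColoop e)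
    (h5 : ¬ ∃ W ⊆ M.E, W.ncard ≤ 10 ∧ W.encard = M.eRk W + 5)
    (h4 : ∃ W ⊆ M.E, W.ncard ≤ 9 ∧ W.encard = M.eRk W + 4) : RLS M 14 5 := by
  classical
  have hd : M.E.encard = M.eRank + ((7 : ℕ) : ℕ∞) := by
    rw [hR, ← M.ground_finite.cast_ncard_eq, hn]
    push_cast
    ring
  obtain ⟨hs3, hs4, hs5⟩ := caps_fourteen_seven_cf M hd hn hfree hK
  have hL0 : ∀ e ∈ M.E, ¬ M.IsLoop e := not_isLoop_of_free M hfree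
  have hs : ∀ e ∈ M.E, ∀ f ∈ M.E, e ≠ f → M.eRk {e, f} = 2 := by
    intro e he f hf hef
    have h2 : (2 : ℕ∞) ≤ M.eRk {e, f} :=
      two_le_eRk_of_two_le_ncard_of_free M hfree (pair_subset he hf) (by rw [ncard_pair hef])
    have h3 : M.eRk {e, f} ≤ 2 := by
      have := M.eRk_le_encard {e, f}
      rwa [encard_pair hef] at this
    exact le_antisymm h3 h2
  have hC1 : ∀ L ⊆ M.E, M.eRk L = 2 → L.ncard ≤ 3 :=
    fun L hL hr => ncard_le_three_of_eRk_two M hs hfree hL hr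
  have hflat : ∀ X ⊆ M.E, M.eRk X ≤ 5 → X.ncard ≤ 9 := fun X hX hr => by
    have := S2.ncard_le_of_eRk_le_of_not_nullity M 5 10 (by norm_num) h5 hX (r := 5) (by norm_num) (by exact_mod_cast hr)
    omega
  have hflat' : ∀ X ⊆ M.E, M.eRk X ≤ 4 → X.ncard ≤ 8 := fun X hX hr => by
    have := S2.ncard_le_of_eRk_le_of_not_nullity M 5 10 (by norm_num) h5 hX (r := 4) (by norm_num) (by exact_mod_cast hr)
    omega
  -- the set `W`
  obtain ⟨W, hW, hWn, hWk⟩ := h4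
  have hWfin : W.Finite := M.ground_finite.subset hW
  have hWne : M.eRk W ≠ ⊤ := ((M.eRk_le_encard W).trans_lt hWfin.encard_lt_top).ne
  obtain ⟨r, hr⟩ := ENat.ne_top_iff_exists.1 hWne
  have hWr : W.ncard = r + 4 := by
    have h := hWk
    rw [← hr, ← hWfin.cast_ncard_eq] at h
    exact_mod_cast h
  have hr4 : 4 ≤ r := by
    by_contra hlt
    push Not at hlt
    have h3 : M.eRk W ≤ 3 := by rw [← hr]; exact_mod_cast (by omega : r ≤ 3)
    have h6 := ncard_le_six_of_eRk_le_three_of_free M hfree hW h3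
    have h2 : M.eRk W ≤ 2 := by rw [← hr]; exact_mod_cast (by omega : r ≤ 2)
    have h3' := S2.ncard_le_three_of_eRk_le_two M hs hC1 hW h2
    omega
  have hr5 : r ≤ 5 := by omega
  -- `W` is a flat
  have hWcl : M.closure W = W := by
    refine le_antisymm ?_ (M.subset_closure W hW)
    intro x hx
    by_contra hxW
    have hxE : x ∈ M.E := M.closure_subset_ground W hx
    apply h5
    refine ⟨insert x W, Set.insert_subset hxE hW, ?_, ?_⟩
    · rw [Set.ncard_insert_of_notMem hxW hWfin]; omega
    · rw [Set.encard_insert_of_notMem hxW, ← M.eRk_closure_eq, M.closure_insert_eq_of_mem_closure hx,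
        M.eRk_closure_eq, hWk]
      ring
  -- the contraction `M ／ W`
  have hNE : (M ／ W).E = M.E \ W := Matroid.contract_ground M W
  have hRW : (M.E \ W).ncard = 21 - (r + 4) := by
    rw [Set.ncard_sdiff hW hWfin, hn, hWr]
  have hNEcard : (M ／ W).E.ncard = 21 - (r + 4) := by rw [hNE, hRW]
  have hNL : ∀ e ∈ (M ／ W).E, ¬ (M ／ W).IsLoop e := S2.contract_not_isLoop_of_closure_eq M hWcl
  have hν : (M ／ W)✶.eRank = ((3 : ℕ) : ℕ∞) := by
    have h := S2.eRank_dual_contract_add M hW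
    rw [hR, ← hr, ← M.ground_finite.sdiff.cast_ncard_eq, hRW] at h
    have h2 : ((r : ℕ) : ℕ∞) + ((21 - (r + 4) : ℕ) : ℕ∞) = ((3 : ℕ) : ℕ∞) + ((14 : ℕ) : ℕ∞) := by
      norm_cast
      omega
    rw [h2] at h
    exact WithTop.add_right_cancel (WithTop.natCast_ne_top 14) h
  -- the counts on `N`
  have hD2N := S2.ncard_dep_two_le (M ／ W) hν hNL
  have hD3N := S2.ncard_dep_three_le (M ／ W) hν hNL
  have hT3N := S2.ncard_allpairs_dep_three_mul_three_le (M ／ W)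
  rw [hNEcard] at hD3N hT3N
  norm_num [Nat.choose] at hD2N hD3N
  have hD1N : {X : Set α | X ⊆ (M ／ W).E ∧ X.ncard = 1 ∧ (M ／ W).Dep X}.ncard = 0 := by
    rw [Set.ncard_eq_zero ((M ／ W).ground_finite.finite_subsets.subset (fun X hX => hX.1)), Set.eq_empty_iff_forall_notMem]
    rintro X ⟨hXE, hX1, hXdep⟩
    obtain ⟨e, rfl⟩ := Set.ncard_eq_one.1 hX1
    exact hNL e (hXE (Set.mem_singleton e)) (Matroid.singleton_dep.1 hXdep)
  have hD0N : {X : Set α | X ⊆ (M ／ W).E ∧ X.ncard = 0 ∧ (M ／ W).Dep X}.ncard = 0 := by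
    rw [Set.ncard_eq_zero ((M ／ W).ground_finite.finite_subsets.subset (fun X hX => hX.1)), Set.eq_empty_iff_forall_notMem]
    rintro X ⟨hXE, hX0, hXdep⟩
    rw [Set.ncard_eq_zero ((M ／ W).ground_finite.subset hXE)] at hX0
    subst hX0
    exact hXdep.not_indep (M ／ W).empty_indep
  -- the counts on `W`
  have hD3W := S2.ncard_dep_three_mul_three_le M hs hC1 hW
  have hR42 := S2.ncard_four_eRk_le_two_eq_zero M hs hC1 hW
  rw [hWr] at hD3W
  -- the splits `I_j + Dep_j ≤ C(w, j)`
  have hsplit : ∀ j, {T : Set α | T ⊆ W ∧ T.ncard = j ∧ M.Indep T}.ncard + {T : Set α | T ⊆ W ∧ T.ncard = j ∧ M.Dep T}.ncard ≤ W.ncard.choose j := by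
    intro j
    rw [← S2.ncard_subsets_ncard_eq W hWfin j, ← Set.ncard_union_eq (Set.disjoint_left.2 (fun T h1 h2 => h2.2.2.not_indep h1.2.2))
      (hWfin.finite_subsets.subset (fun T hT => hT.1)) (hWfin.finite_subsets.subset (fun T hT => hT.1))]
    exact Set.ncard_le_ncard (Set.union_subset (fun T hT => ⟨hT.1, hT.2.1⟩) (fun T hT => ⟨hT.1, hT.2.1⟩)) (hWfin.finite_subsets.subset (fun T hT => hT.1))
  have hsplit4 : {T : Set α | T ⊆ W ∧ T.ncard = 4 ∧ M.Indep T}.ncard + {T : Set α | T ⊆ W ∧ T.ncard = 4 ∧ M.eRk T = 3}.ncard ≤ W.ncard.choose 4 := by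
    rw [← S2.ncard_subsets_ncard_eq W hWfin 4, ← Set.ncard_union_eq (Set.disjoint_left.2 (fun T h1 h2 => by
        have h := h1.2.2.eRk_eq_encard
        rw [h2.2.2, ← (hWfin.subset h1.1).cast_ncard_eq, h1.2.1] at h
        norm_num at h))
      (hWfin.finite_subsets.subset (fun T hT => hT.1)) (hWfin.finite_subsets.subset (fun T hT => hT.1))]
    exact Set.ncard_le_ncard (Set.union_subset (fun T hT => ⟨hT.1, hT.2.1⟩) (fun T hT => ⟨hT.1, hT.2.1⟩)) (hWfin.finite_subsets.subset (fun T hT => hT.1))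
  have hsplit5 : {T : Set α | T ⊆ W ∧ T.ncard = 5 ∧ 4 ≤ M.eRk T}.ncard + {T : Set α | T ⊆ W ∧ T.ncard = 5 ∧ M.eRk T ≤ 3}.ncard ≤ W.ncard.choose 5 := by
    rw [← S2.ncard_subsets_ncard_eq W hWfin 5, ← Set.ncard_union_eq (Set.disjoint_left.2 (fun T h1 h2 => by
        have := h1.2.2.trans h2.2.2
        norm_num at this))
      (hWfin.finite_subsets.subset (fun T hT => hT.1)) (hWfin.finite_subsets.subset (fun T hT => hT.1))]
    exact Set.ncard_le_ncard (Set.union_subset (fun T hT => ⟨hT.1, hT.2.1⟩) (fun T hT => ⟨hT.1, hT.2.1⟩)) (hWfin.finite_subsets.subset (fun T hT => hT.1))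
  have hsub6 : {T : Set α | T ⊆ W ∧ T.ncard = 6 ∧ M.Dep T}.ncard ≤ W.ncard.choose 6 := by
    rw [← S2.ncard_subsets_ncard_eq W hWfin 6]
    exact Set.ncard_le_ncard (fun T hT => ⟨hT.1, hT.2.1⟩) (hWfin.finite_subsets.subset (fun T hT => hT.1))
  have hsub5d : {T : Set α | T ⊆ W ∧ T.ncard = 5 ∧ M.Dep T}.ncard ≤ W.ncard.choose 5 := by
    rw [← S2.ncard_subsets_ncard_eq W hWfin 5]
    exact Set.ncard_le_ncard (fun T hT => ⟨hT.1, hT.2.1⟩) (hWfin.finite_subsets.subset (fun T hT => hT.1))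
  have hsubT3 : {X : Set α | X ⊆ (M ／ W).E ∧ X.ncard = 3 ∧ ∀ x ∈ X, ∀ y ∈ X, x ≠ y → (M ／ W).Dep {x, y}}.ncard ≤
      {X : Set α | X ⊆ (M ／ W).E ∧ X.ncard = 3 ∧ (M ／ W).Dep X}.ncard := by
    refine Set.ncard_le_ncard ?_ ((M ／ W).ground_finite.finite_subsets.subset (fun X hX => hX.1))
    rintro X ⟨hXE, hX3, hpairs⟩
    refine ⟨hXE, hX3, ?_⟩
    obtain ⟨a, b, c, hab, -, -, rfl⟩ := Set.ncard_eq_three.1 hX3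
    exact (hpairs a (Set.mem_insert a _) b (Set.mem_insert_of_mem a (Set.mem_insert b _)) hab).superset
      (Set.pair_subset (Set.mem_insert a _) (Set.mem_insert_of_mem a (Set.mem_insert b _))) hXE
  -- the hitting bounds
  have hhit : ∀ B, B ⊆ M.E → M.eRk (M.E \ B) = M.eRank → B.ncard + 4 ≤ 7 + (B ∩ W).ncard := by
    intro B hBE hBs
    have h := S2.encard_add_le_of_spanning_compl_of_nullity M hBE hW hBs hd hWk hWne (by rw [hR]; exact WithTop.natCast_ne_top 14)
    rw [Set.inter_comm, ← (M.ground_finite.subset hBE).cast_ncard_eq, ← ((M.ground_finite.subset hBE).inter_of_left W).cast_ncard_eq] at h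
    exact_mod_cast h
  have hhit6 : ∀ B, B ⊆ M.E → B.ncard = 6 → M.eRk B = 5 → M.eRk (M.E \ B) = M.eRank → 3 ≤ (B ∩ W).ncard := by
    intro B hBE hB6 _ hBs
    have := hhit B hBE hBs
    omega
  have hhit7 : ∀ B, B ⊆ M.E → B.ncard = 7 → M.eRk B = 5 → M.eRk (M.E \ B) = M.eRank → 4 ≤ (B ∩ W).ncard := by
    intro B hBE hB7 _ hBs
    have := hhit B hBE hBs
    omega
  -- the top count: `5`-, `6`- and `7`-sets
  have hU1 := S2.topCount_le_ncard_compl_spanning (M := M) hR hd 5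
  simp only [Nat.cast_ofNat] at hU1
  have hsplitU : {B : Set α | B ⊆ M.E ∧ M.eRk B = 5 ∧ B.ncard ≤ 7 ∧ M.eRk (M.E \ B) = M.eRank}.ncard ≤
      {B : Set α | B ⊆ M.E ∧ B.ncard = 5 ∧ M.eRk (M.E \ B) = M.eRank}.ncard +
      {B : Set α | B ⊆ M.E ∧ B.ncard = 6 ∧ M.eRk B = 5 ∧ M.eRk (M.E \ B) = M.eRank}.ncard +
      {B : Set α | B ⊆ M.E ∧ B.ncard = 7 ∧ M.eRk B = 5 ∧ M.eRk (M.E \ B) = M.eRank}.ncard := by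
    have hF1 : {B : Set α | B ⊆ M.E ∧ B.ncard = 5 ∧ M.eRk (M.E \ B) = M.eRank}.Finite :=
      M.ground_finite.finite_subsets.subset (fun B hB => hB.1)
    have hF2 : {B : Set α | B ⊆ M.E ∧ B.ncard = 6 ∧ M.eRk B = 5 ∧ M.eRk (M.E \ B) = M.eRank}.Finite :=
      M.ground_finite.finite_subsets.subset (fun B hB => hB.1)
    have hF3 : {B : Set α | B ⊆ M.E ∧ B.ncard = 7 ∧ M.eRk B = 5 ∧ M.eRk (M.E \ B) = M.eRank}.Finite :=
      M.ground_finite.finite_subsets.subset (fun B hB => hB.1)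
    refine le_trans (Set.ncard_le_ncard ?_ ((hF1.union hF2).union hF3)) ?_
    · rintro B ⟨hBE, hB5, hB7, hBs⟩
      have hBfin : B.Finite := M.ground_finite.subset hBE
      have h5le : 5 ≤ B.ncard := by
        have := M.eRk_le_encard B
        rw [hB5, ← hBfin.cast_ncard_eq] at this
        exact_mod_cast this
      rcases (show B.ncard = 5 ∨ B.ncard = 6 ∨ B.ncard = 7 by omega) with h | h | h
      · exact Or.inl (Or.inl ⟨hBE, h, hBs⟩)
      · exact Or.inl (Or.inr ⟨hBE, h, hB5, hBs⟩)
      · exact Or.inr ⟨hBE, h, hB5, hBs⟩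
    · have h1 := Set.ncard_union_le ({B : Set α | B ⊆ M.E ∧ B.ncard = 5 ∧ M.eRk (M.E \ B) = M.eRank} ∪
        {B : Set α | B ⊆ M.E ∧ B.ncard = 6 ∧ M.eRk B = 5 ∧ M.eRk (M.E \ B) = M.eRank})
        {B : Set α | B ⊆ M.E ∧ B.ncard = 7 ∧ M.eRk B = 5 ∧ M.eRk (M.E \ B) = M.eRank}
      have h2 := Set.ncard_union_le {B : Set α | B ⊆ M.E ∧ B.ncard = 5 ∧ M.eRk (M.E \ B) = M.eRank}
        {B : Set α | B ⊆ M.E ∧ B.ncard = 6 ∧ M.eRk B = 5 ∧ M.eRk (M.E \ B) = M.eRank}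
      omega
  have htop5 := S2.ncard_spanning_compl_le_of_nullity M hW hd hWk (m := 5)
  have htop6 := S2.ncard_top_le_sum_contract M hW 6 3 (by norm_num) hhit6
  have htop7 := S2.ncard_top_seven_le_contract M hW hhit7
  rw [Finset.sum_Icc_succ_top (by norm_num : 3 ≤ 6), Finset.sum_Icc_succ_top (by norm_num : 3 ≤ 5),
    Finset.sum_Icc_succ_top (by norm_num : 3 ≤ 4), Finset.Icc_self, Finset.sum_singleton] at htop6
  simp only [show (6 : ℕ) - 3 = 3 from rfl, show (6 : ℕ) - 4 = 2 from rfl, show (6 : ℕ) - 5 = 1 from rfl,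
    show (6 : ℕ) - 6 = 0 from rfl] at htop6
  rw [hNE] at hT3N hD1N hD0N hsubT3
  rw [hD1N, hD0N, hRW] at htop6
  rw [hRW] at htop7
  -- the tail
  have hA := ncard_eRk_le_five_le_flats M 14 7 (by norm_num) hR hn hfree 9 8 hflat hflat' (by norm_num) (by norm_num) (by norm_num) (by norm_num)
    11 56 307 hs3 hs4 hs5
  have hA' : ({X : Set α | X ⊆ M.E ∧ M.eRk X ≤ 5}.ncard : ℚ) ≤ 1508161 / 18 := by
    norm_num [Finset.sum_range_succ, Nat.choose] at hA
    linarith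
  have hS := S2.ncard_spanning_le_of_nullity M hW hd hWk
  rw [hn] at hS htop5
  have cellA : ∀ (U S m : ℕ) (A : ℚ), Matroid.topCount M 14 5 ≤ U → ({X : Set α | X ⊆ M.E ∧ M.eRk X ≤ 5}.ncard : ℚ) ≤ A →
      {X : Set α | X ⊆ M.E ∧ M.eRk X = M.eRank}.ncard ≤ S → m ≤ 1024 →
      1024 * (U : ℚ) ≤ ((1024 - m : ℕ) : ℚ) * 2 ^ (7 - 5) * (12417 : ℚ) →
      (1024 : ℚ) * (A + (S : ℚ)) ≤ (m : ℚ) * 2 ^ 21 → RLS M 14 5 := by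
    intro U S m A hU hA hS hm hpoly htail
    rw [RLS_iff]
    exact c025_core_five_cell_of_counts_xqictq5g M 14 7 (by norm_num) hR hn U hU A hA S hS
      12417 (by norm_num) (phiK 14 5) (by rw [S2.phiK_fourteen_five]; norm_num) ⟨m, hm, hpoly, htail⟩
  -- the products, linearised by the caps
  have hmul : ∀ (a b c : ℕ), b ≤ c → a * b ≤ a * c := fun a b c h => Nat.mul_le_mul_left a h
  rcases (show r = 4 ∨ r = 5 by omega) with hr4e | hr5e
  · -- `w = 8`
    subst hr4e
    have hw : W.ncard = 8 := hWr
    rw [hw] at htop5 hsplit hsplit4 hsplit5 hsub6 hsub5d htop7 hS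
    norm_num [Finset.sum_Icc_succ_top, Nat.choose] at htop5 hS hsplit hsplit4 hsplit5 hsub6 hsub5d hD3W htop6 htop7 hT3N hD3N hsubT3
    have h3 := hsplit 3
    have h4 := hsplit 4
    have h5' := hsplit 5
    have h6 := hsplit 6
    norm_num [Nat.choose] at h3 h4 h5' h6
    have hS' : {X : Set α | X ⊆ M.E ∧ M.eRk X = M.eRank}.ncard ≤ 67166 := by
      refine hS.trans ?_
      decide
    have hU' : Matroid.topCount M 14 5 ≤ 35764 := by
      have m1 := hmul {T : Set α | T ⊆ W ∧ T.ncard = 3 ∧ M.Indep T}.ncard _ _ hD3N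
      have m2 := hmul {T : Set α | T ⊆ W ∧ T.ncard = 4 ∧ M.Indep T}.ncard _ _ hD2N
      have m3 := hmul {T : Set α | T ⊆ W ∧ T.ncard = 4 ∧ M.Indep T}.ncard _ _ hsubT3
      have m4 := hmul {T : Set α | T ⊆ W ∧ T.ncard = 4 ∧ M.Indep T}.ncard _ _ hD3N
      have m5 := hmul {T : Set α | T ⊆ W ∧ T.ncard = 4 ∧ M.eRk T = 3}.ncard _ _ hD3N
      have m6 := hmul {T : Set α | T ⊆ W ∧ T.ncard = 5 ∧ 4 ≤ M.eRk T}.ncard _ _ hD2N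
      rw [hR42] at htop7
      omega
    exact cellA 35764 67166 74 (1508161 / 18) hU' hA' hS' (by norm_num) (by norm_num) (by norm_num)
  · -- `w = 9`
    subst hr5e
    have hw : W.ncard = 9 := hWr
    have hWr5 : M.eRk W = 5 := by rw [← hr]; rfl
    have hR53 := S2.ncard_five_eRk_le_three_le M hfree hs hC1 hW hw hWr5
    rw [hw] at htop5 hsplit hsplit4 hsplit5 hsub6 hsub5d htop7 hS
    norm_num [Finset.sum_Icc_succ_top, Nat.choose] at htop5 hS hsplit hsplit4 hsplit5 hsub6 hsub5d hD3W htop6 htop7 hT3N hD3N hsubT3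
    have h3 := hsplit 3
    have h4 := hsplit 4
    have h5' := hsplit 5
    have h6 := hsplit 6
    norm_num [Nat.choose] at h3 h4 h5' h6
    have hS' : {X : Set α | X ⊆ M.E ∧ M.eRk X = M.eRank}.ncard ≤ 87626 := by
      refine hS.trans ?_
      decide
    have hU' : Matroid.topCount M 14 5 ≤ 45174 := by
      have m1 := hmul {T : Set α | T ⊆ W ∧ T.ncard = 3 ∧ M.Indep T}.ncard _ _ hD3N
      have m2 := hmul {T : Set α | T ⊆ W ∧ T.ncard = 4 ∧ M.Indep T}.ncard _ _ hD2N
      have m3 := hmul {T : Set α | T ⊆ W ∧ T.ncard = 4 ∧ M.Indep T}.ncard _ _ hsubT3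
      have m4 := hmul {T : Set α | T ⊆ W ∧ T.ncard = 4 ∧ M.Indep T}.ncard _ _ hD3N
      have m5 := hmul {T : Set α | T ⊆ W ∧ T.ncard = 4 ∧ M.eRk T = 3}.ncard _ _ hD3N
      have m6 := hmul {T : Set α | T ⊆ W ∧ T.ncard = 5 ∧ 4 ≤ M.eRk T}.ncard _ _ hD2N
      rw [hR42] at htop7
      omega
    exact cellA 45174 87626 84 (1508161 / 18) hU' hA' hS' (by norm_num) (by norm_num) (by norm_num)

end ThmN

end PercRepro
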